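import Mathlib
import HarnessLib
import Summits.AtomisticToContinuum.FouriersLaw.Theses.JunctionLocality
import Summits.AtomisticToContinuum.FouriersLaw.Theorems.JunctionLocalitySuperadditiveResistanceKuboGreen

/-!
# Cold-bath relocation, I: the two-weight cross Green identity and the relocation increment at cutoff level

Helper file (`--supports` stmt-AtomisticToContinuum-11749) for stub `stub_bulkStep` (R5) of the line
`cold-bath-relocation-walk` of the crux `JunctionLocality.ConductanceLowerBound`.  Setting: the pinned chain
`P = pinnedChain ω₂ lam β γ` (`ω₂ > 0`, `lam, β ≥ 0`), one temperature `T > 0`, `ρ = e^{-H/T}` (`gibbsDensity`),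
`X_H = liouvilleOp`, `S_B = bathOp L B T` (weighted Ornstein–Uhlenbeck thermostats), `thermo L s T` the single-site
thermostat, `kin L 0 − T = p_0² − T` the source, `χ_n = Kubo.chi` the energy cutoffs of the landed Kubo toolkit.

* `cross_level_two` / `helper_relocCrossLevelTwoWeights` — the cross Green identity at cutoff level for a forward pair
  `σ X_H f + c S_B f = −k_f` and a backward pair `−σ X_H h + c S_{B'} h = −k_h` with TWO weight vectors `B`, `B'`:
  `∫ χ_n h k_f ρ − ∫ χ_n f k_h ρ = cT Σ_i (B_i − B'_i) ∫ χ_n ∂_{p_i}f ∂_{p_i}h ρ + cT Σ_i ∫ (B_i h ∂_{p_i}f − B'_i f ∂_{p_i}h) ∂_{p_i}χ_n ρ`,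
  derived exactly as `Kubo.cross_level` (antisymmetry of `X_H` at cutoff level, `integral_chi_liouville_antisymm`, and the
  bath integration by parts `integral_chi_mul_bathOp`); the carré-du-champ terms no longer cancel and leave the first
  sum.  For `B = B'` it is literally `Kubo.cross_level`.
* `reloc_increment_level` / `helper_relocIncrementLevel` — the specialisation to the relocation walk (`1 ≤ m`, `m + 2 ≤ L`):
  a forward field `g` of `X_H + γ(S_0 + S_m)` (cold bath on site `m`) against a backward field `h` of
  `−X_H + γ(S_0 + S_{m+1})` (cold bath on site `m+1`), both with source `k_0`:
  `∫ χ_n h k_0 ρ − ∫ χ_n g k_0 ρ = γT(∫ χ_n ∂_m g ∂_m h ρ − ∫ χ_n ∂_{m+1} g ∂_{m+1} h ρ)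
     + γT(∫ (h ∂_0 g − g ∂_0 h) ∂_0χ_n ρ + ∫ h ∂_m g ∂_mχ_n ρ − ∫ g ∂_{m+1} h ∂_{m+1}χ_n ρ)`.
The `n → ∞` limit (the "second resolvent identity" of the step `m → m+1`) is part II (`…RelocCrossLevelAux1`).

References: folklore (Green's identities for `σX_H + cS_B` in `L²(e^{-H/T} dx)`; Eckmann–Pillet–Rey-Bellet 1999 §3).
-/

noncomputable section

open MeasureTheory Filter Topology
open scoped ContDiff
open Literature.MathematicalPhysics.KineticTheory.HeatConduction
open Summit.AtomisticToContinuum.FouriersLaw.Theorems.SuperadditiveResistance.DeviceLiouville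
open Summit.AtomisticToContinuum.FouriersLaw.Theorems.SuperadditiveResistance.Kubo
  (chi contDiff_chi hasCompactSupport_chi integral_chi_liouville_antisymm integral_chi_mul_bathOp
    continuous_liouvilleOp continuous_bathOp)

namespace Summit.AtomisticToContinuum.FouriersLaw.Cruxes.ConductanceLowerBound.ColdBathRelocationWalk

/-! ## The two-weight cross Green identity at cutoff level -/

section CrossTwo

variable {ω₂ lam β γ : ℝ} {L : ℕ}

/-- Bookkeeping: `Σ_i B_i (I_i + U_i) − Σ_i B'_i (I_i + V_i) = Σ_i (B_i − B'_i) I_i + Σ_i (B_i U_i − B'_i V_i)`.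
[folklore] -/
theorem sum_cross_two_aux (B B' I U V : Fin L → ℝ) :
    (∑ i, B i * (I i + U i)) - ∑ i, B' i * (I i + V i) =
      (∑ i, (B i - B' i) * I i) + ∑ i, (B i * U i - B' i * V i) := by
  rw [← Finset.sum_sub_distrib, ← Finset.sum_add_distrib]
  exact Finset.sum_congr rfl fun i _ => by ring

/-- **Two-weight cross Green identity at cutoff level** (a `σ`-pair for the weights `B` against a `(−σ)`-pair for
the weights `B'`): `∫ χ_n h k_f ρ − ∫ χ_n f k_h ρ = cT Σ_i (B_i − B'_i) ∫ χ_n ∂_{p_i}f ∂_{p_i}h ρ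
+ cT Σ_i ∫ (B_i h ∂_{p_i}f − B'_i f ∂_{p_i}h) ∂_{p_i}χ_n ρ`. [folklore] -/
theorem cross_level_two (hω : 0 < ω₂) (hl : 0 ≤ lam) (hβ : 0 ≤ β) (L : ℕ) {T : ℝ} (hT : 0 < T)
    (B B' : Fin L → ℝ) (σ c : ℝ) {f kf h kh : PhaseSpace L → ℝ} (hf : ContDiff ℝ 2 f) (hh : ContDiff ℝ 2 h)
    (hpf : ∀ x, σ * liouvilleOp (pinnedChain ω₂ lam β γ) L f x + c * bathOp L B T f x = -kf x)
    (hph : ∀ x, -σ * liouvilleOp (pinnedChain ω₂ lam β γ) L h x + c * bathOp L B' T h x = -kh x) (n : ℕ) :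
    (∫ x, chi (pinnedChain ω₂ lam β γ) L n x * h x * kf x * (pinnedChain ω₂ lam β γ).gibbsDensity L T x) -
      (∫ x, chi (pinnedChain ω₂ lam β γ) L n x * f x * kh x * (pinnedChain ω₂ lam β γ).gibbsDensity L T x) =
      c * T * (∑ i, (B i - B' i) * ∫ x, chi (pinnedChain ω₂ lam β γ) L n x * partialP i f x * partialP i h x *
          (pinnedChain ω₂ lam β γ).gibbsDensity L T x) +
      c * T * ∑ i, ∫ x, (B i * (h x * partialP i f x) - B' i * (f x * partialP i h x)) *
          partialP i (chi (pinnedChain ω₂ lam β γ) L n) x * (pinnedChain ω₂ lam β γ).gibbsDensity L T x := by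
  -- adapted from `Kubo.cross_level` (…SuperadditiveResistanceKuboGreen), with two weight vectors
  set P := pinnedChain ω₂ lam β γ with hP
  have hHs : ContDiff ℝ ∞ (P.hamiltonian L) :=
    P.contDiff_hamiltonian (pinnedChain_contDiff_U ω₂ lam β γ) (pinnedChain_contDiff_V ω₂ lam β γ) L
  have hχs : ContDiff ℝ ∞ (chi P L n) := contDiff_chi hHs n
  have hχ1 : ContDiff ℝ 1 (chi P L n) := hχs.of_le (by norm_cast)
  have hχcont : Continuous (chi P L n) := hχs.continuous
  have hχc : HasCompactSupport (chi P L n) := hasCompactSupport_chi hω hl hβ γ L n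
  have hχd : Differentiable ℝ (chi P L n) := hχ1.differentiable one_ne_zero
  have hdχc : ∀ j, Continuous (partialP j (chi P L n)) := fun j => continuous_partialP hχ1 one_ne_zero j
  have hdχs : ∀ j, HasCompactSupport (partialP j (chi P L n)) := fun j => hasCompactSupport_partialP hχd hχc j
  have hf1 : ContDiff ℝ 1 f := hf.of_le (by norm_cast)
  have hh1 : ContDiff ℝ 1 h := hh.of_le (by norm_cast)
  have hfc : Continuous f := hf.continuous
  have hhc : Continuous h := hh.continuous
  have hdfc : ∀ j, Continuous (partialP j f) := fun j => continuous_partialP hf1 one_ne_zero j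
  have hdhc : ∀ j, Continuous (partialP j h) := fun j => continuous_partialP hh1 one_ne_zero j
  have hρc : Continuous (P.gibbsDensity L T) := pinnedChain_continuous_gibbsDensity ω₂ lam β γ L T
  have hXfc : Continuous (liouvilleOp P L f) := continuous_liouvilleOp L hf
  have hXhc : Continuous (liouvilleOp P L h) := continuous_liouvilleOp L hh
  have hSfc : Continuous (bathOp L B T f) := continuous_bathOp L B T hf
  have hShc : Continuous (bathOp L B' T h) := continuous_bathOp L B' T hh
  -- named integrals
  set Wa : ℝ := ∫ x, chi P L n x * h x * liouvilleOp P L f x * P.gibbsDensity L T x with hWa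
  set Wb : ℝ := ∫ x, chi P L n x * f x * liouvilleOp P L h x * P.gibbsDensity L T x with hWb
  set S1 : ℝ := ∫ x, chi P L n x * h x * bathOp L B T f x * P.gibbsDensity L T x with hS1
  set S2 : ℝ := ∫ x, chi P L n x * f x * bathOp L B' T h x * P.gibbsDensity L T x with hS2
  set I : Fin L → ℝ := fun i => ∫ x, chi P L n x * partialP i f x * partialP i h x * P.gibbsDensity L T x
    with hI
  set U : Fin L → ℝ := fun i => ∫ x, h x * partialP i (chi P L n) x * partialP i f x * P.gibbsDensity L T x
    with hU
  set V : Fin L → ℝ := fun i => ∫ x, f x * partialP i (chi P L n) x * partialP i h x * P.gibbsDensity L T x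
    with hV
  have hIXa : Integrable fun x => chi P L n x * h x * liouvilleOp P L f x * P.gibbsDensity L T x :=
    Continuous.integrable_of_hasCompactSupport (by fun_prop) (hχc.mul_right.mul_right.mul_right)
  have hIXb : Integrable fun x => chi P L n x * f x * liouvilleOp P L h x * P.gibbsDensity L T x :=
    Continuous.integrable_of_hasCompactSupport (by fun_prop) (hχc.mul_right.mul_right.mul_right)
  have hIS1 : Integrable fun x => chi P L n x * h x * bathOp L B T f x * P.gibbsDensity L T x :=
    Continuous.integrable_of_hasCompactSupport (by fun_prop) (hχc.mul_right.mul_right.mul_right)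
  have hIS2 : Integrable fun x => chi P L n x * f x * bathOp L B' T h x * P.gibbsDensity L T x :=
    Continuous.integrable_of_hasCompactSupport (by fun_prop) (hχc.mul_right.mul_right.mul_right)
  -- antisymmetry: Wa + Wb = 0
  have hA : Wa + Wb = 0 := by
    have e := integral_chi_liouville_antisymm hω hl hβ γ L hT.ne' hh hf n
    have hsplit : (fun x => chi P L n x * (h x * liouvilleOp P L f x + f x * liouvilleOp P L h x) *
        P.gibbsDensity L T x) = fun x => chi P L n x * h x * liouvilleOp P L f x * P.gibbsDensity L T x +
          chi P L n x * f x * liouvilleOp P L h x * P.gibbsDensity L T x := by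
      funext x; ring
    rw [hsplit, integral_add hIXa hIXb] at e
    exact e
  -- the two bath integrations by parts (different weights)
  have hB1 : S1 = -T * ∑ i, B i * (I i + U i) := by
    have e := integral_chi_mul_bathOp hω hl hβ γ L B hT.ne' hh hf n
    have hsym : ∀ i, (fun x => chi P L n x * partialP i h x * partialP i f x * P.gibbsDensity L T x) =
        fun x => chi P L n x * partialP i f x * partialP i h x * P.gibbsDensity L T x := by
      intro i; funext x; ring
    rw [← hP] at e
    simp only [hsym] at e
    exact e
  have hB2 : S2 = -T * ∑ i, B' i * (I i + V i) := integral_chi_mul_bathOp hω hl hβ γ L B' hT.ne' hf hh n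
  -- integrate the pointwise equations against `χ_n h ρ` and `χ_n f ρ`
  have hpt1 : (fun x => chi P L n x * h x * kf x * P.gibbsDensity L T x) = fun x =>
      -(σ * (chi P L n x * h x * liouvilleOp P L f x * P.gibbsDensity L T x) +
        c * (chi P L n x * h x * bathOp L B T f x * P.gibbsDensity L T x)) := by
    funext x
    have e1 : kf x = -(σ * liouvilleOp P L f x + c * bathOp L B T f x) := by have := hpf x; linarith
    rw [e1]; ring
  have hpt2 : (fun x => chi P L n x * f x * kh x * P.gibbsDensity L T x) = fun x =>
      -(-σ * (chi P L n x * f x * liouvilleOp P L h x * P.gibbsDensity L T x) +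
        c * (chi P L n x * f x * bathOp L B' T h x * P.gibbsDensity L T x)) := by
    funext x
    have e2 : kh x = -(-σ * liouvilleOp P L h x + c * bathOp L B' T h x) := by have := hph x; linarith
    rw [e2]; ring
  have hL1 : ∫ x, chi P L n x * h x * kf x * P.gibbsDensity L T x = -(σ * Wa + c * S1) := by
    rw [hpt1, integral_neg, integral_add (hIXa.const_mul σ) (hIS1.const_mul c), integral_const_mul,
      integral_const_mul]
  have hL2 : ∫ x, chi P L n x * f x * kh x * P.gibbsDensity L T x = -(-σ * Wb + c * S2) := by
    rw [hpt2, integral_neg, integral_add (hIXb.const_mul (-σ)) (hIS2.const_mul c), integral_const_mul,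
      integral_const_mul]
  -- the weighted cutoff-gradient integrals
  have hI1 : ∀ i, Integrable fun x => h x * partialP i (chi P L n) x * partialP i f x * P.gibbsDensity L T x :=
    fun i => Continuous.integrable_of_hasCompactSupport (by fun_prop) (((hdχs i).mul_left).mul_right.mul_right)
  have hI2 : ∀ i, Integrable fun x => f x * partialP i (chi P L n) x * partialP i h x * P.gibbsDensity L T x :=
    fun i => Continuous.integrable_of_hasCompactSupport (by fun_prop) (((hdχs i).mul_left).mul_right.mul_right)
  have hcomb : ∀ i, B i * U i - B' i * V i =
      ∫ x, (B i * (h x * partialP i f x) - B' i * (f x * partialP i h x)) * partialP i (chi P L n) x *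
        P.gibbsDensity L T x := by
    intro i
    simp only [hU, hV]
    rw [← integral_const_mul, ← integral_const_mul, ← integral_sub ((hI1 i).const_mul _) ((hI2 i).const_mul _)]
    refine integral_congr_ae (ae_of_all _ fun x => ?_)
    ring
  rw [hL1, hL2, hB1, hB2,
    show ∑ i, (B i - B' i) * ∫ x, chi P L n x * partialP i f x * partialP i h x * P.gibbsDensity L T x =
        ∑ i, (B i - B' i) * I i from rfl,
    show ∑ i, ∫ x, (B i * (h x * partialP i f x) - B' i * (f x * partialP i h x)) * partialP i (chi P L n) x *
        P.gibbsDensity L T x = ∑ i, (B i * U i - B' i * V i) from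
      Finset.sum_congr rfl fun i _ => (hcomb i).symm]
  linear_combination (-σ) * hA + (c * T) * sum_cross_two_aux B B' I U V

end CrossTwo

/-- Registered helper `helper_relocCrossLevelTwoWeights` toward stub `stub_bulkStep` (= `cross_level_two` in stub form; line
`cold-bath-relocation-walk`, crux stmt-AtomisticToContinuum-11749). [folklore] -/
theorem helper_relocCrossLevelTwoWeights : ∀ {ω₂ lam β γ : ℝ}, 0 < ω₂ → 0 ≤ lam → 0 ≤ β → ∀ (L : ℕ) {T : ℝ}, 0 < T → ∀ (B B' : Fin L → ℝ) (σ c : ℝ) {f kf h kh : PhaseSpace L → ℝ}, ContDiff ℝ 2 f → ContDiff ℝ 2 h → (∀ x, σ * liouvilleOp (pinnedChain ω₂ lam β γ) L f x + c * bathOp L B T f x = -kf x) → (∀ x, -σ * liouvilleOp (pinnedChain ω₂ lam β γ) L h x + c * bathOp L B' T h x = -kh x) → ∀ n : ℕ, (∫ x, chi (pinnedChain ω₂ lam β γ) L n x * h x * kf x * (pinnedChain ω₂ lam β γ).gibbsDensity L T x) - (∫ x, chi (pinnedChain ω₂ lam β γ) L n x * f x * kh x * (pinnedChain ω₂ lam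 β γ).gibbsDensity L T x) = c * T * (∑ i, (B i - B' i) * ∫ x, chi (pinnedChain ω₂ lam β γ) L n x * partialP i f x * partialP i h x * (pinnedChain ω₂ lam β γ).gibbsDensity L T x) + c * T * ∑ i, ∫ x, (B i * (h x * partialP i f x) - B' i * (f x * partialP i h x)) * partialP i (chi (pinnedChain ω₂ lam β γ) L n) x * (pinnedChain ω₂ lam β γ).gibbsDensity L T x :=
  @cross_level_two


/-! ## The relocation increment at cutoff level -/

section Increment

variable {ω₂ lam β γ : ℝ} {L : ℕ}

/-- A sum over `Fin L` of a family supported on the three sites `0, m, m+1` (`1 ≤ m`, `m + 2 ≤ L`). [folklore] -/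
theorem sum_eq_three_sites {m : ℕ} (hm : 1 ≤ m) (hmL : m + 2 ≤ L) (F : Fin L → ℝ)
    (hF : ∀ i : Fin L, i.val ≠ 0 → i.val ≠ m → i.val ≠ m + 1 → F i = 0) :
    ∑ i, F i = F ⟨0, by omega⟩ + F ⟨m, by omega⟩ + F ⟨m + 1, by omega⟩ := by
  have h0m : (⟨0, by omega⟩ : Fin L) ∉ ({⟨m, by omega⟩, ⟨m + 1, by omega⟩} : Finset (Fin L)) := by
    simp only [Finset.mem_insert, Finset.mem_singleton, Fin.ext_iff]
    omega
  have hmm : (⟨m, by omega⟩ : Fin L) ∉ ({⟨m + 1, by omega⟩} : Finset (Fin L)) := by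
    simp only [Finset.mem_singleton, Fin.ext_iff]
    omega
  rw [← Finset.sum_subset (Finset.subset_univ
      ({⟨0, by omega⟩, ⟨m, by omega⟩, ⟨m + 1, by omega⟩} : Finset (Fin L))),
    Finset.sum_insert h0m, Finset.sum_insert hmm, Finset.sum_singleton, add_assoc]
  intro i _ hi
  simp only [Finset.mem_insert, Finset.mem_singleton, Fin.ext_iff, not_or] at hi
  exact hF i hi.1 hi.2.1 hi.2.2

/-- **The relocation increment at cutoff level.** For a forward field `g` of `X_H + γ(S_0 + S_m)` and a backward
field `h` of `−X_H + γ(S_0 + S_{m+1})`, both with source `k_0 = p_0² − T` (`1 ≤ m`, `m + 2 ≤ L`):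
`∫ χ_n h k_0 ρ − ∫ χ_n g k_0 ρ = γT(∫ χ_n ∂_m g ∂_m h ρ − ∫ χ_n ∂_{m+1} g ∂_{m+1} h ρ)
  + γT(∫ (h ∂_0 g − g ∂_0 h) ∂_0χ_n ρ + ∫ h ∂_m g ∂_mχ_n ρ − ∫ g ∂_{m+1} h ∂_{m+1}χ_n ρ)`. [folklore] -/
theorem reloc_increment_level (hω : 0 < ω₂) (hl : 0 ≤ lam) (hβ : 0 ≤ β) {L m : ℕ} (hm : 1 ≤ m)
    (hmL : m + 2 ≤ L) {T : ℝ} (hT : 0 < T) {g h : PhaseSpace L → ℝ} (hg : ContDiff ℝ 2 g) (hh : ContDiff ℝ 2 h)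
    (hpg : ∀ x, liouvilleOp (pinnedChain ω₂ lam β γ) L g x + γ * (thermo L 0 T g x + thermo L m T g x) =
      -(kin L 0 x - T))
    (hph : ∀ x, -liouvilleOp (pinnedChain ω₂ lam β γ) L h x + γ * (thermo L 0 T h x + thermo L (m + 1) T h x) =
      -(kin L 0 x - T)) (n : ℕ) :
    (∫ x, chi (pinnedChain ω₂ lam β γ) L n x * h x * (kin L 0 x - T) * (pinnedChain ω₂ lam β γ).gibbsDensity L T x) -
      (∫ x, chi (pinnedChain ω₂ lam β γ) L n x * g x * (kin L 0 x - T) *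
        (pinnedChain ω₂ lam β γ).gibbsDensity L T x) =
      γ * T * ((∫ x, chi (pinnedChain ω₂ lam β γ) L n x * partialP ⟨m, by omega⟩ g x *
          partialP ⟨m, by omega⟩ h x * (pinnedChain ω₂ lam β γ).gibbsDensity L T x) -
        ∫ x, chi (pinnedChain ω₂ lam β γ) L n x * partialP ⟨m + 1, by omega⟩ g x *
          partialP ⟨m + 1, by omega⟩ h x * (pinnedChain ω₂ lam β γ).gibbsDensity L T x) +
      γ * T * ((∫ x, (h x * partialP ⟨0, by omega⟩ g x - g x * partialP ⟨0, by omega⟩ h x) *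
          partialP ⟨0, by omega⟩ (chi (pinnedChain ω₂ lam β γ) L n) x * (pinnedChain ω₂ lam β γ).gibbsDensity L T x) +
        (∫ x, h x * partialP ⟨m, by omega⟩ g x * partialP ⟨m, by omega⟩ (chi (pinnedChain ω₂ lam β γ) L n) x *
          (pinnedChain ω₂ lam β γ).gibbsDensity L T x) -
        ∫ x, g x * partialP ⟨m + 1, by omega⟩ h x * partialP ⟨m + 1, by omega⟩ (chi (pinnedChain ω₂ lam β γ) L n) x *
          (pinnedChain ω₂ lam β γ).gibbsDensity L T x) := by
  have hm0 : (0 : ℕ) ≠ m := by omega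
  have hm0' : (0 : ℕ) ≠ m + 1 := by omega
  have hmm' : m ≠ m + 1 := by omega
  have hm'm : m + 1 ≠ m := by omega
  have hm'0 : m + 1 ≠ 0 := by omega
  have hmne : m ≠ 0 := by omega
  set P := pinnedChain ω₂ lam β γ with hP
  -- the bridge `S_{𝟙_0 + 𝟙_s} = thermo 0 + thermo s` (as the skeleton's `bathOp_relocWeight`)
  have hbridge : ∀ (s : ℕ) (u : PhaseSpace L → ℝ) (x : PhaseSpace L),
      bathOp L (fun i : Fin L => (if i.val = 0 then (1 : ℝ) else 0) + (if i.val = s then 1 else 0)) T u x =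
        thermo L 0 T u x + thermo L s T u x := by
    intro s u x
    unfold bathOp thermo
    rw [← Finset.sum_add_distrib]
    refine Finset.sum_congr rfl fun i _ => ?_
    dsimp only
    split_ifs <;> ring
  -- the two pairs in weighted form
  have hpg' : ∀ x, 1 * liouvilleOp P L g x +
      γ * bathOp L (fun i : Fin L => (if i.val = 0 then (1 : ℝ) else 0) + (if i.val = m then 1 else 0)) T g x =
        -(kin L 0 x - T) := fun x => by
    rw [one_mul, hbridge]; exact hpg x
  have hph' : ∀ x, -1 * liouvilleOp P L h x +
      γ * bathOp L (fun i : Fin L => (if i.val = 0 then (1 : ℝ) else 0) + (if i.val = m + 1 then 1 else 0)) T h x =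
        -(kin L 0 x - T) := fun x => by
    rw [neg_one_mul, hbridge]; exact hph x
  rw [hP, cross_level_two hω hl hβ L hT _ _ 1 γ hg hh hpg' hph' n]
  congr 1
  · congr 1
    rw [sum_eq_three_sites hm hmL _ (fun i h0 hm1 hm2 => by simp [h0, hm1, hm2])]
    simp only [hm0, hmne, hm0', hmm', hm'm, hm'0, if_true, if_false]
    ring
  · congr 1
    rw [sum_eq_three_sites hm hmL _ (fun i h0 hm1 hm2 => by simp [h0, hm1, hm2])]
    simp only [hm0, hm0', hmm', hm'm, hm'0, hmne, if_true, if_false, add_zero, zero_add, one_mul, zero_mul,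
      sub_zero, zero_sub, neg_mul, integral_neg]
    ring

end Increment

/-- Registered helper `helper_relocIncrementLevel` toward stub `stub_bulkStep` (= `reloc_increment_level` in stub form; line
`cold-bath-relocation-walk`, crux stmt-AtomisticToContinuum-11749). [folklore] -/
theorem helper_relocIncrementLevel : ∀ {ω₂ lam β γ : ℝ}, 0 < ω₂ → 0 ≤ lam → 0 ≤ β → ∀ {L m : ℕ} (hm : 1 ≤ m) (hmL : m + 2 ≤ L) {T : ℝ}, 0 < T → ∀ {g h : PhaseSpace L → ℝ}, ContDiff ℝ 2 g → ContDiff ℝ 2 h → (∀ x, liouvilleOp (pinnedChain ω₂ lam β γ) L g x + γ * (thermo L 0 T g x + thermo L m T g x) = -(kin L 0 x - T)) → (∀ x, -liouvilleOp (pinnedChain ω₂ lam β γ) L h x + γ * (thermo L 0 T h x + thermo L (m + 1) T h x) = -(kin L 0 x - T)) → ∀ n : ℕ, (∫ x, chi (pinnedChain ω₂ lam β γ) L n x * h x * (kin L 0 x - T) * (pinnedChain ω₂ lam β γ).gibbsDensity L T x) - (∫ x, chi (pinnedChain ω₂ lam β γ) L n x * g x * (kin L 0 x - T) * (pinnedChain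 ω₂ lam β γ).gibbsDensity L T x) = γ * T * ((∫ x, chi (pinnedChain ω₂ lam β γ) L n x * partialP ⟨m, by omega⟩ g x * partialP ⟨m, by omega⟩ h x * (pinnedChain ω₂ lam β γ).gibbsDensity L T x) - ∫ x, chi (pinnedChain ω₂ lam β γ) L n x * partialP ⟨m + 1, by omega⟩ g x * partialP ⟨m + 1, by omega⟩ h x * (pinnedChain ω₂ lam β γ).gibbsDensity L T x) + γ * T * ((∫ x, (h x * partialP ⟨0, by omega⟩ g x - g x * partialP ⟨0, by omega⟩ h x) * partialP ⟨0, by omega⟩ (chi (pinnedChain ω₂ lam β γ) L n) x * (pinnedChain ω₂ lam β γ).gibbsDensity L T x) + (∫ x, h x * partialP ⟨m, by omega⟩ g x * partialP ⟨m, by omega⟩ (chi (pinnedChain ω₂ lam β γ) L n) x * (pinnedChain ω₂ lam β γ).gibbsDensity L T x) - ∫ x, g x * partialP ⟨m + 1, by omega⟩ h x * partialP ⟨m + 1, by omega⟩ (chi (pinnedChain ω₂ lam β γ) L n) x * (pinnedChain ω₂ lam β γ).gibbsDensity L T x) :=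
  @reloc_increment_level

end Summit.AtomisticToContinuum.FouriersLaw.Cruxes.ConductanceLowerBound.ColdBathRelocationWalk

end
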